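import Literature.IUT.LogVolume.PilotSlotResidueSupport
import Mathlib.Algebra.BigOperators.Fin
import Mathlib.Algebra.BigOperators.Ring.Finset
import Mathlib.Algebra.BigOperators.Group.Finset.Piecewise
import Mathlib.Tactic.Positivity
import Mathlib.Tactic.FieldSimp
import HarnessLib

/-!
# The (Ind1) slot residue IS the `log(q)`-share at the MIXED primes — two-sided, closed form

PROOF-ONLY sequel to `PilotSlotResidue.lean` / `PilotSlotResidueBounds.lean` / `PilotSlotResidueSupport.lean`
(abc-iut cell; R2 S-chain seat abc-iut-s2-p2, lineage abc-iut-S8). Dupuy–Hilado, arXiv:2004.13228 [DupuyHilado2025]: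
§3.3 (`P_{Θ,j} = j²·P_q`, supported on the chosen bad places `S`), §3.6 (weights `Pr(v) = n_v/[F:ℚ]`,
`Σ_{v|p} Pr(v) = 1`, product weights on collections `v⃗ ∈ V(F)_p^{j+1}`, procession average `(1/ℓ⋆)Σ_j`), §4.7
((Ind1) = permutations of the tensor factors), §4.11–4.12; S. Mochizuki, *IUT IV* [Mochizuki2012], proof of
Thm. 1.10 Step (v) p. 27–28 ("after symmetrizing with respect to the choice of "`i† ∈ I`" … does not affect the
computation of the upper bound"); the cell's audit note HOME/plan/c312/STEPV-IND1-NOTE.md §4 (quantitative appendix: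
"a `w`-fraction `ω` of `E` has `μ = 0` … `m_j ≤ (1−ω)^{j+1}·max μ`").

NOTATION (nothing is defined; every quantity below is spelled out as a finite sum in the statements). For pilot data
`X = (F, j_E, S, l)`, a prime `p` and a place `v | p`: `μ(v) := P_q(v)·ln|κ(v)|/n_v` (`≥ 0`, `= 0` iff `v ∉ S`),
`θ_j(v) = j²·μ(v)` (`slotValue_eq_sq_mul`), `μ̄_p := Σ_{v|p} μ(v)·Pr(v)` — the `p`-part of `deĝ̲(P_q)` — and
`c_ℓ := (ℓ⋆+1)(2ℓ⋆+1)/6 = (1/ℓ⋆)Σ_{j≤ℓ⋆} j²` (`procAvg_sq`), so that `c_ℓ·μ̄_p` is the `p`-part of the last-slot aggregate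
`ndegLgpOn` (`= deĝ̲_lgp(P_Θ)`, i.e. `((l+1)/24)·log(q)` at `p`: `ndegLgpOn_eq_sum_avgSq_mul`). For a set `Z` of places
over `p` OUTSIDE `S` (good places, or bad places not chosen) write `ω_Z := Σ_{v∈Z} Pr(v)`.

WHAT IS PROVED (pure finite-sum combinatorics; no packets, volumes or ideles):
* `inner_defect_sum_ge_zeroWeight` — per `(p, j)`: `(Σ_v θ_j(v)Pr(v))·(1 − (1−ω_Z)^{j}) ≤ Σ_{v⃗}(θ_j(v⃗(j)) − min_k θ_j(v⃗(k)))·Π Pr`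
  (`j = i+1` = number of non-distinguished slots + … ; proof: the minimum over the `j+1` slots is `0` as soon as ONE slot
  falls in `Z`, and is `≤` the last slot otherwise; by independence of the slots the surviving weight is `(1−ω_Z)^{j}`
  on the first `j` slots — the last slot's own `Z`-part carries `θ = 0`);
* **`slotResidue_ge_mixedShare`** — summed with the procession weights:
  `Σ_{p∈T} μ̄_p·(c_ℓ − (1/ℓ⋆)·Σ_{i<ℓ⋆}(i+1)²(1−ω_{Z_p})^{i+1}) ≤ slotResidue X T` for any choice of zero-sets `Z_p`;
  the unprocessed form `slotResidue_ge_mixedShare_sum` keeps `(1/ℓ⋆)Σ(i+1)²(1−(1−ω)^{i+1})`;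
* **`slotResidue_le_mixedShare`** — `slotResidue X T ≤ Σ_{p ∈ T ∖ C} c_ℓ·μ̄_p` for any set `C` of primes at which `X` is
  slot-constant (there the defect vanishes termwise; elsewhere defect `≤` last slot);
* `ndegLgpOn_eq_sum_avgSq_mul` — `ndegLgpOn X T = Σ_{p∈T} c_ℓ·μ̄_p` (last-slot marginal).
So at a prime `p ∈ T` over which a set of non-`S` places of weight `ω_p > 0` lies (a «mixed» prime: some chosen bad
place and some good/un-chosen place of `F` over the same `p`), the residue captures the fraction
`1 − (6/(ℓ⋆(ℓ⋆+1)(2ℓ⋆+1)))·Σ_{i<ℓ⋆}(i+1)²(1−ω_p)^{i+1} ≥ 1 − 12(1−ω_p)/(ω_p³·ℓ⋆(ℓ⋆+1)(2ℓ⋆+1))` of the WHOLE `p`-part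
`c_ℓ·μ̄_p` of `deĝ̲_lgp(P_Θ)` — not merely the `Pr(v)·Pr(w)`-fraction of one pair (`slotResidue_ge_pair_closed`): e.g.
`≥ 3/7` at `l = 7`, `ω = 1/2`; `≥ 0.91` at `l = 13`; `→ 1` as `l → ∞`; and it never exceeds `c_ℓ·μ̄_p`, vanishing at
slot-constant primes. Combined with the summit-side necessity `HullEstimateOf δ → slotResidue ≤ δ` (abc-iut-S8,
`LDHSlotResidue.lean`) this identifies the Diophantine content of the (U)-line child (ii′) of stmt-ABC-19678 at
`d_mod ≥ 2` with «the `((l+1)/24)·log(q)`-share of the bad/good-MIXED primes of `F_mod` is `≤ δ`, up to `1+O(ℓ⁻²)`»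
(summit-side sequel `LDHSlotResidueMixedShare.lean`). Nothing here takes a side on [IUTchIII] Cor. 3.12 or asserts
anything about [IUTchIV] Thm. 1.10 beyond consequences of the typed definitions; typed ≠ endorsed.
-/

noncomputable section

namespace Literature.IUT.LogVolume

open NumberField IsDedekindDomain Finset

namespace PilotData

variable {F : Type*} [Field F] [NumberField F] (X : PilotData F)

/-! ## Plumbing: nonnegativity and the last-slot marginal -/

/-- `P_q(v) ≥ 0` (coefficient `ord_v(q_v)/(2l) > 0` on `S`, `0` off `S`). [cite: DupuyHilado2025, §3.3] -/
private theorem qPilot_apply_nonneg (v : HeightOneSpectrum (𝓞 F)) : 0 ≤ X.qPilot v := by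
  classical
  simp only [qPilot, FinDivisor.of, Finsupp.finsetSum_apply, Finsupp.single_apply, Finset.sum_ite_eq']
  split_ifs with hv
  · have h1 : (0 : ℝ) ≤ (X.ordq v : ℝ) := by exact_mod_cast (X.ordq_pos hv).le
    exact div_nonneg h1 X.two_mul_l_pos.le
  · exact le_rfl

/-- `μ(v) = P_q(v)·ln|κ(v)|/n_v ≥ 0`. [cite: DupuyHilado2025, §3.3–3.4] -/
private theorem mu_nonneg (v : HeightOneSpectrum (𝓞 F)) :
    0 ≤ X.qPilot v * logNorm F v / (localDegree F v : ℝ) :=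
  div_nonneg (mul_nonneg (X.qPilot_apply_nonneg v) (logNorm_pos F v).le) (Nat.cast_nonneg _)

/-- `θ_j(v) ≥ 0`. [cite: DupuyHilado2025, §3.4] -/
private theorem slotValue_nonneg' (i : Fin X.lstar) (v : HeightOneSpectrum (𝓞 F)) : 0 ≤ X.slotValue i v := by
  rw [slotValue_eq_sq_mul]
  exact mul_nonneg (by positivity) (X.mu_nonneg v)

/-- **Last-slot marginal against product weights**: for `w, g : S → ℝ` and `m`,
`Σ_{e : Fin (m+1) → S} g(e(m))·Π_k w(e(k)) = (Σ_s g(s)·w(s))·(Σ_s w(s))^m`. [folklore] -/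
private theorem sum_last_mul_prod_eq {S : Type*} [Fintype S] [DecidableEq S] (w g : S → ℝ) (m : ℕ) :
    ∑ e : Fin (m + 1) → S, g (e (Fin.last m)) * ∏ k, w (e k) =
      (∑ s, g s * w s) * (∑ s, w s) ^ m := by
  have key : ∀ e : Fin (m + 1) → S, g (e (Fin.last m)) * ∏ k, w (e k) =
      ∏ k, (w (e k) * (if k = Fin.last m then g (e k) else 1)) := by
    intro e
    rw [Finset.prod_mul_distrib, Fintype.prod_ite_eq']
    ring
  rw [Finset.sum_congr rfl (fun e _ => key e)]
  have hswap : ∑ e : Fin (m + 1) → S, ∏ k, (w (e k) * (if k = Fin.last m then g (e k) else 1)) =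
      ∏ k : Fin (m + 1), ∑ s : S, (w s * (if k = Fin.last m then g s else 1)) := by
    rw [Finset.prod_univ_sum, Fintype.piFinset_univ]
  rw [hswap]
  have hk : ∀ k : Fin (m + 1), ∑ s : S, (w s * (if k = Fin.last m then g s else 1)) =
      if k = Fin.last m then ∑ s, g s * w s else ∑ s, w s := by
    intro k
    split_ifs with h
    · exact Finset.sum_congr rfl fun s _ => by ring
    · simp only [mul_one]
  rw [Finset.prod_congr rfl (fun k _ => hk k), Fin.prod_univ_castSucc]
  simp only [Fin.castSucc_ne_last, if_false, if_true, Finset.prod_const, Finset.card_univ,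
    Fintype.card_fin]
  ring

/-- `Σ_{v|p} θ_j(v)·Pr(v) = j²·μ̄_p`. [cite: DupuyHilado2025, §3.3] -/
private theorem sum_slotValue_mul_weight (p : ℕ) (i : Fin X.lstar) :
    ∑ v : placesOver F p, X.slotValue i v.1 * weight F v.1 =
      (((i : ℕ) + 1 : ℝ) ^ 2) *
        ∑ v : placesOver F p, X.qPilot v.1 * logNorm F v.1 / (localDegree F v.1 : ℝ) * weight F v.1 := by
  rw [Finset.mul_sum]
  refine Finset.sum_congr rfl fun v _ => ?_
  rw [slotValue_eq_sq_mul]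
  ring

/-- `μ̄_p ≥ 0`. [cite: DupuyHilado2025, §3.3, §3.6] -/
theorem sum_mu_mul_weight_nonneg (p : ℕ) :
    0 ≤ ∑ v : placesOver F p, X.qPilot v.1 * logNorm F v.1 / (localDegree F v.1 : ℝ) * weight F v.1 :=
  Finset.sum_nonneg fun v _ => mul_nonneg (X.mu_nonneg v.1) (weight_nonneg F v.1)

/-! ## The last-slot aggregate in closed form -/

/-- **The last-slot aggregate prime by prime**: for a finite set of primes `T`,
`ndegLgpOn X T = Σ_{p∈T} c_ℓ·μ̄_p` with `c_ℓ = (ℓ⋆+1)(2ℓ⋆+1)/6` and `μ̄_p = Σ_{v|p} P_q(v)·ln|κ(v)|/n_v·Pr(v)` (the other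
`j` slots integrate out: `Σ_{v|p} Pr(v) = 1`). [cite: DupuyHilado2025, §3.6, Thm. 3.10.1] -/
theorem ndegLgpOn_eq_sum_avgSq_mul (T : Finset ℕ) (hT : ∀ p ∈ T, p.Prime) :
    X.ndegLgpOn T = ∑ p ∈ T, (((X.lstar : ℝ) + 1) * (2 * X.lstar + 1) / 6) *
      ∑ v : placesOver F p, X.qPilot v.1 * logNorm F v.1 / (localDegree F v.1 : ℝ) * weight F v.1 := by
  classical
  unfold ndegLgpOn
  refine Finset.sum_congr rfl fun p hp => ?_
  haveI : Fact p.Prime := ⟨hT p hp⟩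
  have hin : ∀ i : Fin X.lstar, ∑ e : Fin ((i : ℕ) + 1 + 1) → placesOver F p,
      X.slotValue i (e (Fin.last _)).1 * ∏ k, weight F (e k).1 =
        (((i : ℕ) + 1 : ℝ) ^ 2) *
          ∑ v : placesOver F p, X.qPilot v.1 * logNorm F v.1 / (localDegree F v.1 : ℝ) * weight F v.1 := by
    intro i
    rw [sum_last_mul_prod_eq (fun v : placesOver F p => weight F v.1) (fun v => X.slotValue i v.1),
      sum_weight_placesOver p, one_pow, mul_one, X.sum_slotValue_mul_weight p i]
  rw [Finset.sum_congr rfl (fun i _ => hin i), ← Finset.sum_mul, ← mul_assoc, procAvg_sq]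

/-! ## The lower bound: the minimum is killed by one slot outside `S` -/

open scoped Classical in
/-- Pointwise: for a collection `v⃗` and a set `Z` of places over `p` outside `S`,
`(min_k θ_j(v⃗(k)))·Π_k Pr(v⃗(k)) ≤ θ_j(v⃗(last))·Π_k (Pr(v⃗(k))·𝟙[v⃗(k) ∉ Z])` — if some slot lies in `Z` the minimum is
`θ = 0` there, otherwise the two weight products agree and `min ≤ last`. [cite: DupuyHilado2025, §3.3, §4.7] -/
private theorem inf'_mul_prod_le (p : ℕ) (i : Fin X.lstar) (Z : Finset (placesOver F p))
    (hZ : ∀ v ∈ Z, v.1 ∉ X.S) (e : Fin ((i : ℕ) + 1 + 1) → placesOver F p) :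
    Finset.univ.inf' Finset.univ_nonempty (fun k => X.slotValue i (e k).1) * ∏ k, weight F (e k).1 ≤
      X.slotValue i (e (Fin.last _)).1 * ∏ k, (weight F (e k).1 * (if e k ∈ Z then (0 : ℝ) else 1)) := by
  classical
  by_cases h : ∃ k, e k ∈ Z
  · obtain ⟨k₀, hk₀⟩ := h
    have hzero : ∏ k, (weight F (e k).1 * (if e k ∈ Z then (0 : ℝ) else 1)) = 0 :=
      Finset.prod_eq_zero (Finset.mem_univ k₀) (by rw [if_pos hk₀, mul_zero])
    rw [hzero, mul_zero]
    have hmin : Finset.univ.inf' Finset.univ_nonempty (fun k => X.slotValue i (e k).1) ≤ 0 := by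
      have h1 := Finset.inf'_le (fun k => X.slotValue i (e k).1) (Finset.mem_univ k₀)
      have h2 : X.slotValue i (e k₀).1 = 0 := X.slotValue_eq_zero_of_not_mem i (hZ _ hk₀)
      simpa only [h2] using h1
    exact mul_nonpos_iff.mpr (Or.inr ⟨hmin, prod_weight_nonneg e⟩)
  · push Not at h
    have hone : ∏ k, (weight F (e k).1 * (if e k ∈ Z then (0 : ℝ) else 1)) = ∏ k, weight F (e k).1 :=
      Finset.prod_congr rfl fun k _ => by rw [if_neg (h k), mul_one]
    rw [hone]
    exact mul_le_mul_of_nonneg_right (Finset.inf'_le _ (Finset.mem_univ _)) (prod_weight_nonneg e)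

/-- **Per procession index, the zero-weight lower bound.** For a prime `p`, an index `j = i+1`, and a set `Z` of places of
`F` over `p` OUTSIDE `S` with total weight `ω_Z = Σ_{v∈Z} Pr(v)`:
`(Σ_{v|p} θ_j(v)·Pr(v))·(1 − (1−ω_Z)^{i+1}) ≤ Σ_{v⃗∈V(F)_p^{j+1}} (θ_j(v⃗(j)) − min_k θ_j(v⃗(k)))·Π_k Pr(v⃗(k))` — the
collections with at least one of the first `i+1` slots in `Z` have minimum `0` and carry weight `1 − (1−ω_Z)^{i+1}`
against the last-slot marginal. This is STEPV-IND1-NOTE §4's `m_j ≤ (1−ω)^{j+1}·μ̄`-type estimate at the level of the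
typed finite sums. [cite: Mochizuki2012, IUTchIV Thm. 1.10 Step (v) p. 27–28] [cite: DupuyHilado2025, §3.6, §4.7] -/
theorem inner_defect_sum_ge_zeroWeight (p : ℕ) [Fact p.Prime] (i : Fin X.lstar) (Z : Finset (placesOver F p))
    (hZ : ∀ v ∈ Z, v.1 ∉ X.S) :
    (∑ v : placesOver F p, X.slotValue i v.1 * weight F v.1) *
        (1 - (1 - ∑ v ∈ Z, weight F v.1) ^ ((i : ℕ) + 1)) ≤
      ∑ e : Fin ((i : ℕ) + 1 + 1) → placesOver F p,
        (X.slotValue i (e (Fin.last _)).1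
          - Finset.univ.inf' Finset.univ_nonempty (fun k => X.slotValue i (e k).1)) *
          ∏ k, weight F (e k).1 := by
  classical
  set A : ℝ := ∑ v : placesOver F p, X.slotValue i v.1 * weight F v.1 with hA
  set B : ℝ := 1 - ∑ v ∈ Z, weight F v.1 with hB
  have hsplit : ∑ e : Fin ((i : ℕ) + 1 + 1) → placesOver F p,
      (X.slotValue i (e (Fin.last _)).1
        - Finset.univ.inf' Finset.univ_nonempty (fun k => X.slotValue i (e k).1)) * ∏ k, weight F (e k).1 =
      (∑ e : Fin ((i : ℕ) + 1 + 1) → placesOver F p, X.slotValue i (e (Fin.last _)).1 * ∏ k, weight F (e k).1)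
        - ∑ e : Fin ((i : ℕ) + 1 + 1) → placesOver F p,
          Finset.univ.inf' Finset.univ_nonempty (fun k => X.slotValue i (e k).1) * ∏ k, weight F (e k).1 := by
    rw [← Finset.sum_sub_distrib]
    exact Finset.sum_congr rfl fun e _ => by ring
  have hlast : ∑ e : Fin ((i : ℕ) + 1 + 1) → placesOver F p,
      X.slotValue i (e (Fin.last _)).1 * ∏ k, weight F (e k).1 = A := by
    rw [hA, sum_last_mul_prod_eq (fun v : placesOver F p => weight F v.1) (fun v => X.slotValue i v.1),
      sum_weight_placesOver p, one_pow, mul_one]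
  have hwZ : ∑ v : placesOver F p, weight F v.1 * (if v ∈ Z then (0 : ℝ) else 1) = B := by
    have h1 : ∑ v : placesOver F p, weight F v.1 * (if v ∈ Z then (0 : ℝ) else 1) =
        ∑ v : placesOver F p, weight F v.1 - ∑ v : placesOver F p, (if v ∈ Z then weight F v.1 else 0) := by
      rw [← Finset.sum_sub_distrib]
      refine Finset.sum_congr rfl fun v _ => ?_
      split_ifs <;> ring
    rw [h1, sum_weight_placesOver p, Finset.sum_ite_mem, Finset.univ_inter]
  have hθZ : ∑ v : placesOver F p, X.slotValue i v.1 * (weight F v.1 * (if v ∈ Z then (0 : ℝ) else 1)) = A := by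
    rw [hA]
    refine Finset.sum_congr rfl fun v _ => ?_
    by_cases hv : v ∈ Z
    · rw [if_pos hv, X.slotValue_eq_zero_of_not_mem i (hZ v hv)]; ring
    · rw [if_neg hv, mul_one]
  have hmin : ∑ e : Fin ((i : ℕ) + 1 + 1) → placesOver F p,
      Finset.univ.inf' Finset.univ_nonempty (fun k => X.slotValue i (e k).1) * ∏ k, weight F (e k).1 ≤
        A * B ^ ((i : ℕ) + 1) := by
    calc ∑ e : Fin ((i : ℕ) + 1 + 1) → placesOver F p,
          Finset.univ.inf' Finset.univ_nonempty (fun k => X.slotValue i (e k).1) * ∏ k, weight F (e k).1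
        ≤ ∑ e : Fin ((i : ℕ) + 1 + 1) → placesOver F p,
            X.slotValue i (e (Fin.last _)).1 * ∏ k, (weight F (e k).1 * (if e k ∈ Z then (0 : ℝ) else 1)) :=
          Finset.sum_le_sum fun e _ => X.inf'_mul_prod_le p i Z hZ e
      _ = (∑ v : placesOver F p, X.slotValue i v.1 * (weight F v.1 * (if v ∈ Z then (0 : ℝ) else 1))) *
            (∑ v : placesOver F p, weight F v.1 * (if v ∈ Z then (0 : ℝ) else 1)) ^ ((i : ℕ) + 1) :=
          sum_last_mul_prod_eq (fun v : placesOver F p => weight F v.1 * (if v ∈ Z then (0 : ℝ) else 1))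
            (fun v => X.slotValue i v.1) ((i : ℕ) + 1)
      _ = A * B ^ ((i : ℕ) + 1) := by rw [hθZ, hwZ]
  rw [hsplit, hlast]
  have hring : A * (1 - B ^ ((i : ℕ) + 1)) = A - A * B ^ ((i : ℕ) + 1) := by ring
  rw [hring]
  linarith

/-- **The mixed-share LOWER bound for the (Ind1) slot residue (unprocessed form).** For a finite set of primes `T` and,
at each `p ∈ T`, any set `Z_p` of places of `F` over `p` outside `S` (weight `ω_p = Σ_{v∈Z_p} Pr(v)`):
`Σ_{p∈T} μ̄_p·(1/ℓ⋆)·Σ_{i<ℓ⋆} (i+1)²·(1 − (1−ω_p)^{i+1}) ≤ slotResidue X T`, `μ̄_p = Σ_{v|p} P_q(v)·ln|κ(v)|/n_v·Pr(v)`.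
[cite: DupuyHilado2025, §4.7, §4.11, §4.12] [cite: Mochizuki2012, IUTchIV Thm. 1.10 Step (v) p. 27–28] -/
theorem slotResidue_ge_mixedShare_sum (T : Finset ℕ) (hT : ∀ p ∈ T, p.Prime)
    (Z : (p : ℕ) → Finset (placesOver F p)) (hZ : ∀ p ∈ T, ∀ v ∈ Z p, v.1 ∉ X.S) :
    ∑ p ∈ T, (∑ v : placesOver F p, X.qPilot v.1 * logNorm F v.1 / (localDegree F v.1 : ℝ) * weight F v.1) *
        ((1 / (X.lstar : ℝ)) * ∑ i : Fin X.lstar,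
          (((i : ℕ) + 1 : ℝ) ^ 2) * (1 - (1 - ∑ v ∈ Z p, weight F v.1) ^ ((i : ℕ) + 1))) ≤
      X.slotResidue T := by
  classical
  rw [slotResidue_eq_sum]
  refine Finset.sum_le_sum fun p hp => ?_
  haveI : Fact p.Prime := ⟨hT p hp⟩
  rw [mul_left_comm, Finset.mul_sum]
  refine mul_le_mul_of_nonneg_left (Finset.sum_le_sum fun i _ => ?_) (by positivity)
  have h := X.inner_defect_sum_ge_zeroWeight p i (Z p) (hZ p hp)
  rw [X.sum_slotValue_mul_weight p i] at h
  calc (∑ v : placesOver F p, X.qPilot v.1 * logNorm F v.1 / (localDegree F v.1 : ℝ) * weight F v.1) *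
        ((((i : ℕ) + 1 : ℝ) ^ 2) * (1 - (1 - ∑ v ∈ Z p, weight F v.1) ^ ((i : ℕ) + 1)))
      = (((i : ℕ) + 1 : ℝ) ^ 2) *
          (∑ v : placesOver F p, X.qPilot v.1 * logNorm F v.1 / (localDegree F v.1 : ℝ) * weight F v.1) *
          (1 - (1 - ∑ v ∈ Z p, weight F v.1) ^ ((i : ℕ) + 1)) := by ring
    _ ≤ _ := h

/-- **The mixed-share LOWER bound, processed**: with `c_ℓ = (ℓ⋆+1)(2ℓ⋆+1)/6 = (1/ℓ⋆)Σ_{i<ℓ⋆}(i+1)²`,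
`Σ_{p∈T} μ̄_p·(c_ℓ − (1/ℓ⋆)·Σ_{i<ℓ⋆}(i+1)²(1−ω_p)^{i+1}) ≤ slotResidue X T` — at a prime over which non-`S` places of
weight `ω_p` lie, the residue captures the `p`-part `c_ℓ·μ̄_p` of `deĝ̲_lgp(P_Θ)` up to the geometric tail
`(1/ℓ⋆)Σ(i+1)²(1−ω_p)^{i+1}` (`≤ 2(1−ω_p)/(ℓ⋆·ω_p³)`, summit-side closed form). [cite: DupuyHilado2025, §4.7, §4.11, §4.12]
[cite: Mochizuki2012, IUTchIV Thm. 1.10 Step (v) p. 27–28] -/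
theorem slotResidue_ge_mixedShare (T : Finset ℕ) (hT : ∀ p ∈ T, p.Prime)
    (Z : (p : ℕ) → Finset (placesOver F p)) (hZ : ∀ p ∈ T, ∀ v ∈ Z p, v.1 ∉ X.S) :
    ∑ p ∈ T, (∑ v : placesOver F p, X.qPilot v.1 * logNorm F v.1 / (localDegree F v.1 : ℝ) * weight F v.1) *
        ((((X.lstar : ℝ) + 1) * (2 * X.lstar + 1) / 6)
          - (1 / (X.lstar : ℝ)) * ∑ i : Fin X.lstar,
              (((i : ℕ) + 1 : ℝ) ^ 2) * (1 - ∑ v ∈ Z p, weight F v.1) ^ ((i : ℕ) + 1)) ≤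
      X.slotResidue T := by
  have h := X.slotResidue_ge_mixedShare_sum T hT Z hZ
  refine le_trans (le_of_eq (Finset.sum_congr rfl fun p _ => ?_)) h
  congr 1
  rw [← procAvg_sq, ← mul_sub, ← Finset.sum_sub_distrib]
  congr 1
  exact Finset.sum_congr rfl fun i _ => by ring

/-! ## The upper bound: no residue beyond the `p`-part, none at slot-constant primes -/

/-- Per prime: the defect sum at `(p, j)` is at most the last-slot marginal `j²·μ̄_p` (the least slot is `≥ 0`).
[cite: DupuyHilado2025, §4.7] -/
theorem inner_defect_sum_le (p : ℕ) [Fact p.Prime] (i : Fin X.lstar) :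
    ∑ e : Fin ((i : ℕ) + 1 + 1) → placesOver F p,
        (X.slotValue i (e (Fin.last _)).1
          - Finset.univ.inf' Finset.univ_nonempty (fun k => X.slotValue i (e k).1)) *
          ∏ k, weight F (e k).1 ≤
      (((i : ℕ) + 1 : ℝ) ^ 2) *
        ∑ v : placesOver F p, X.qPilot v.1 * logNorm F v.1 / (localDegree F v.1 : ℝ) * weight F v.1 := by
  classical
  have hlast : ∑ e : Fin ((i : ℕ) + 1 + 1) → placesOver F p,
      X.slotValue i (e (Fin.last _)).1 * ∏ k, weight F (e k).1 =
        (((i : ℕ) + 1 : ℝ) ^ 2) *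
          ∑ v : placesOver F p, X.qPilot v.1 * logNorm F v.1 / (localDegree F v.1 : ℝ) * weight F v.1 := by
    rw [sum_last_mul_prod_eq (fun v : placesOver F p => weight F v.1) (fun v => X.slotValue i v.1),
      sum_weight_placesOver p, one_pow, mul_one, X.sum_slotValue_mul_weight p i]
  rw [← hlast]
  refine Finset.sum_le_sum fun e _ => ?_
  have hw : 0 ≤ ∏ k, weight F (e k).1 := prod_weight_nonneg e
  have hmin : 0 ≤ Finset.univ.inf' Finset.univ_nonempty (fun k => X.slotValue i (e k).1) := by
    obtain ⟨k, _, hk⟩ := Finset.exists_mem_eq_inf' Finset.univ_nonempty (fun k => X.slotValue i (e k).1)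
    rw [hk]
    exact X.slotValue_nonneg' i _
  nlinarith

/-- **The mixed-share UPPER bound for the (Ind1) slot residue.** For a finite set of primes `T` and any finite set `C` of
primes at which the pilot data are slot-constant (`θ_j` constant on `V(F)_p`; e.g. one place over `p`, or all places over
`p` in `S` with the same `μ`): `slotResidue X T ≤ Σ_{p ∈ T ∖ C} c_ℓ·μ̄_p` — the residue lives on the NON-slot-constant
(«mixed») primes and never exceeds their share `c_ℓ·μ̄_p` of `deĝ̲_lgp(P_Θ)`. [cite: DupuyHilado2025, §4.7, §4.11, §4.12]
[cite: Mochizuki2012, IUTchIV Thm. 1.10 Step (v) p. 28] -/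
theorem slotResidue_le_mixedShare (T C : Finset ℕ) (hT : ∀ p ∈ T, p.Prime)
    (hC : ∀ p ∈ C, ∀ (i : Fin X.lstar) (v w : placesOver F p), X.slotValue i v.1 = X.slotValue i w.1) :
    X.slotResidue T ≤ ∑ p ∈ T \ C, (((X.lstar : ℝ) + 1) * (2 * X.lstar + 1) / 6) *
      ∑ v : placesOver F p, X.qPilot v.1 * logNorm F v.1 / (localDegree F v.1 : ℝ) * weight F v.1 := by
  classical
  rw [slotResidue_eq_sum, ← Finset.sum_filter_add_sum_filter_not T (fun p => p ∈ C)]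
  -- the slot-constant primes contribute nothing
  have hzero : ∑ p ∈ T.filter (fun p => p ∈ C), (1 / (X.lstar : ℝ)) * ∑ i : Fin X.lstar,
      ∑ e : Fin ((i : ℕ) + 1 + 1) → placesOver F p,
        (X.slotValue i (e (Fin.last _)).1
          - Finset.univ.inf' Finset.univ_nonempty (fun k => X.slotValue i (e k).1)) *
          ∏ k, weight F (e k).1 = 0 := by
    refine Finset.sum_eq_zero fun p hp => ?_
    rw [Finset.mem_filter] at hp
    rw [Finset.sum_eq_zero fun i _ => ?_, mul_zero]
    refine Finset.sum_eq_zero fun e _ => ?_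
    have hconst : Finset.univ.inf' Finset.univ_nonempty (fun k => X.slotValue i (e k).1) =
        X.slotValue i (e (Fin.last _)).1 := by
      refine le_antisymm (Finset.inf'_le _ (Finset.mem_univ _)) ?_
      exact Finset.le_inf' _ _ fun k _ => (hC p hp.2 i (e (Fin.last _)) (e k)).le
    rw [hconst, sub_self, zero_mul]
  rw [hzero, zero_add, ← Finset.sdiff_eq_filter]
  refine Finset.sum_le_sum fun p hp => ?_
  haveI : Fact p.Prime := ⟨hT p (Finset.mem_sdiff.mp hp).1⟩
  have hl : (0 : ℝ) ≤ 1 / (X.lstar : ℝ) := by positivity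
  calc (1 / (X.lstar : ℝ)) * ∑ i : Fin X.lstar, ∑ e : Fin ((i : ℕ) + 1 + 1) → placesOver F p,
          (X.slotValue i (e (Fin.last _)).1
            - Finset.univ.inf' Finset.univ_nonempty (fun k => X.slotValue i (e k).1)) * ∏ k, weight F (e k).1
      ≤ (1 / (X.lstar : ℝ)) * ∑ i : Fin X.lstar, ((((i : ℕ) + 1 : ℝ) ^ 2) *
          ∑ v : placesOver F p, X.qPilot v.1 * logNorm F v.1 / (localDegree F v.1 : ℝ) * weight F v.1) :=
        mul_le_mul_of_nonneg_left (Finset.sum_le_sum fun i _ => X.inner_defect_sum_le p i) hl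
    _ = (((X.lstar : ℝ) + 1) * (2 * X.lstar + 1) / 6) *
          ∑ v : placesOver F p, X.qPilot v.1 * logNorm F v.1 / (localDegree F v.1 : ℝ) * weight F v.1 := by
        rw [← Finset.sum_mul, ← mul_assoc, procAvg_sq]

/-- **Two-sided, in one line**: for primes `T`, zero-sets `Z_p` outside `S` and slot-constant primes `C`,
`Σ_{p∈T} μ̄_p·(c_ℓ − tail_p) ≤ slotResidue X T ≤ Σ_{p∈T∖C} c_ℓ·μ̄_p`. [cite: DupuyHilado2025, §4.7, §4.11, §4.12] -/
theorem slotResidue_mixedShare_two_sided (T C : Finset ℕ) (hT : ∀ p ∈ T, p.Prime)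
    (Z : (p : ℕ) → Finset (placesOver F p)) (hZ : ∀ p ∈ T, ∀ v ∈ Z p, v.1 ∉ X.S)
    (hC : ∀ p ∈ C, ∀ (i : Fin X.lstar) (v w : placesOver F p), X.slotValue i v.1 = X.slotValue i w.1) :
    ∑ p ∈ T, (∑ v : placesOver F p, X.qPilot v.1 * logNorm F v.1 / (localDegree F v.1 : ℝ) * weight F v.1) *
        ((((X.lstar : ℝ) + 1) * (2 * X.lstar + 1) / 6)
          - (1 / (X.lstar : ℝ)) * ∑ i : Fin X.lstar,
              (((i : ℕ) + 1 : ℝ) ^ 2) * (1 - ∑ v ∈ Z p, weight F v.1) ^ ((i : ℕ) + 1)) ≤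
      X.slotResidue T ∧
    X.slotResidue T ≤ ∑ p ∈ T \ C, (((X.lstar : ℝ) + 1) * (2 * X.lstar + 1) / 6) *
      ∑ v : placesOver F p, X.qPilot v.1 * logNorm F v.1 / (localDegree F v.1 : ℝ) * weight F v.1 :=
  ⟨X.slotResidue_ge_mixedShare T hT Z hZ, X.slotResidue_le_mixedShare T C hT hC⟩

end PilotData

end Literature.IUT.LogVolume

end
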